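import Literature.ModelTheory.ExponentialFields.TarskiSeidenbergProofs
import Mathlib.Algebra.Polynomial.Roots
import Mathlib.Algebra.Polynomial.BigOperators
import Mathlib.MeasureTheory.Measure.Lebesgue.Basic
import Mathlib.Data.Set.Card
import Mathlib.Data.Set.Card.Arithmetic
import HarnessLib

/-!
# Uniform finiteness for semialgebraic families with countable fibres

Topic `Literature/ModelTheory/ExponentialFields` (next to `Semialgebraic.lean` and the proved
Tarski–Seidenberg theorem `tarski_seidenberg_real_holds`). The **uniform finiteness** property of
semialgebraic families over `ℝ` in the elementary special case of *countable* fibres: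

> if `s ⊆ ℝᵐ × ℝᴺ` is semialgebraic, there is `B ∈ ℕ` such that every countable fibre
> `s_β = {x ∈ ℝᴺ : (β, x) ∈ s}` has at most `B` points.

(van den Dries, *Tame topology and o-minimal structures* (1998), Ch. 3, (3.7): in an o-minimal
structure a definable family of finite sets has uniformly bounded size; Bochnak–Coste–Roy,
*Real Algebraic Geometry* (1998), §2.3. For countable — in particular discrete — fibres no cell
decomposition is needed: a countable semialgebraic subset of the line is contained in the zeros of
the nonzero polynomials of any sign-condition presentation, whose number is bounded by the total
degrees; several coordinates are handled by projecting, with the Tarski–Seidenberg theorem, onto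
the last coordinate and inducting.) Everything is **proved**:

* `natDegree_aeval_le_totalDegree` — substituting polynomials of degree `≤ 1` for the variables
  of `q` yields a one-variable polynomial of degree `≤ totalDegree q`;
* `IsSemialgebraic.exists_forall_encard_fibre_one_le` — the case `N = 1`;
* `IsSemialgebraic.exists_forall_encard_fibre_le` — the general case, fibres
  `{x : ℝᴺ | Fin.append β x ∈ s}` of `s ⊆ ℝ^{m+N}`;
* `IsSemialgebraic.exists_forall_encard_sumElim_le` — the same for `s ⊆ ℝ^{m ⊕ N}` and fibres
  `{x | Sum.elim β x ∈ s}` (the form used for zero sets of parametrised terms);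
* `countable_of_forall_exists_nhds_inter_subset` — a set all of whose points are isolated is
  countable (second-countable spaces; via a countable basis), the source of countable fibres in
  the intended application to non-degenerate zeros of exp-free term systems (Khovanskii's
  finiteness theorem, forthcoming `KhovanskiiZeroBound.lean`).

## References

* L. van den Dries, *Tame topology and o-minimal structures*, LMS Lecture Note Ser. 248 (1998),
  Ch. 3, (3.7) (uniform finiteness).
* J. Bochnak, M. Coste, M.-F. Roy, *Real Algebraic Geometry* (1998), §2.1, §2.3, Thm. 2.2.1.
  [BochnakCosteRoy1998]
-/

noncomputable section

open Set MvPolynomial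

namespace Literature.ModelTheory.ExponentialFields

/-! ### Degree of a one-variable specialisation -/

/-- Substituting one-variable polynomials of degree `≤ 1` for the variables of `q` gives a
polynomial of degree at most the total degree of `q`. [folklore] -/
theorem natDegree_aeval_le_totalDegree {k R σ : Type*} [CommRing k] [CommRing R] [Algebra k R]
    (q : MvPolynomial σ k) (g : σ → Polynomial R) (hg : ∀ i, (g i).natDegree ≤ 1) :
    (aeval g q).natDegree ≤ q.totalDegree := by
  classical
  rw [aeval_def, eval₂_eq]
  refine Polynomial.natDegree_sum_le_of_forall_le _ _ fun d hd => ?_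
  refine (Polynomial.natDegree_mul_le).trans ?_
  have h1 : ((algebraMap k (Polynomial R)) (coeff d q)).natDegree = 0 := by
    rw [Polynomial.algebraMap_apply] ; exact Polynomial.natDegree_C _
  rw [h1, zero_add]
  refine (Polynomial.natDegree_prod_le _ _).trans ?_
  refine le_trans (Finset.sum_le_sum fun i _ => (Polynomial.natDegree_pow_le).trans
    (Nat.mul_le_mul_left (d i) (hg i))) ?_
  simp only [mul_one]
  exact le_totalDegree hd

/-! ### Isolated points -/

/-- A set all of whose points are isolated (each `x ∈ s` has a neighbourhood meeting `s` only in
`x`) is countable, in a second-countable space. [folklore] -/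
theorem countable_of_forall_exists_nhds_inter_subset {X : Type*} [TopologicalSpace X]
    [SecondCountableTopology X] {s : Set X}
    (hs : ∀ x ∈ s, ∃ U ∈ nhds x, U ∩ s ⊆ {x}) : s.Countable := by
  obtain ⟨b, hbc, -, hb⟩ := TopologicalSpace.exists_countable_basis X
  have hchoice : ∀ x ∈ s, ∃ t ∈ b, x ∈ t ∧ t ∩ s ⊆ {x} := by
    intro x hx
    obtain ⟨U, hU, hUs⟩ := hs x hx
    obtain ⟨t, htb, hxt, htU⟩ := hb.mem_nhds_iff.1 hU
    exact ⟨t, htb, hxt, fun y hy => hUs ⟨htU hy.1, hy.2⟩⟩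
  choose! f hfb hxf hfs using hchoice
  refine MapsTo.countable_of_injOn (f := f) (fun x hx => hfb x hx) (fun x hx y hy hxy => ?_) hbc
  have hy' : y ∈ f x ∩ s := ⟨hxy ▸ hxf y hy, hy⟩
  exact (hfs x hx hy').symm

/-! ### One coordinate -/

section One

variable {k : Type*} [CommRing k] [Algebra k ℝ] {n : ℕ}

/-- The one-variable specialisation of `q` at the parameter `β`: substitute `β` for the first `n`
variables and `X` for the last. [folklore] -/
def specLast (q : MvPolynomial (Fin (n + 1)) k) (β : Fin n → ℝ) : Polynomial ℝ :=
  aeval (Fin.snoc (fun j => Polynomial.C (β j)) Polynomial.X : Fin (n + 1) → Polynomial ℝ) q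

/-- Evaluating the specialisation at `t` is evaluating `q` at `(β, t)`. [folklore] -/
theorem eval_specLast (q : MvPolynomial (Fin (n + 1)) k) (β : Fin n → ℝ) (t : ℝ) :
    (specLast q β).eval t = aeval (Fin.snoc β t : Fin (n + 1) → ℝ) q := by
  have hsnoc : ∀ i : Fin (n + 1),
      ((Fin.snoc (fun j => Polynomial.C (β j)) Polynomial.X : Fin (n + 1) → Polynomial ℝ) i).eval t
        = (Fin.snoc β t : Fin (n + 1) → ℝ) i := by
    intro i
    refine Fin.lastCases ?_ (fun j => ?_) i
    · simp
    · simp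
  induction q using MvPolynomial.induction_on with
  | C a => simp [specLast, Polynomial.algebraMap_apply]
  | add p q hp hq =>
    simp only [specLast, map_add, Polynomial.eval_add] at hp hq ⊢
    rw [hp, hq]
  | mul_X p i hp =>
    simp only [specLast, map_mul, Polynomial.eval_mul, aeval_X] at hp ⊢
    rw [hp, hsnoc]

/-- The specialisation has degree at most the total degree of `q`. [folklore] -/
theorem natDegree_specLast_le (q : MvPolynomial (Fin (n + 1)) k) (β : Fin n → ℝ) :
    (specLast q β).natDegree ≤ q.totalDegree := by
  refine natDegree_aeval_le_totalDegree q _ fun i => ?_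
  refine Fin.lastCases ?_ (fun j => ?_) i
  · simp
  · simp

/-- **Countable fibres of a semialgebraic family on the line are uniformly finite.** For a
`k`-semialgebraic `s ⊆ ℝ^{n+1}` there is `B` such that every countable fibre
`{t | (β, t) ∈ s}` has at most `B` elements (`B = Σ_q totalDegree q` over a sign-condition
presentation of `s`: a point of a countable fibre must be a root of a nonzero specialised `q`,
otherwise all signs are locally constant around it and the fibre contains an interval).
[cite: BochnakCosteRoy1998, §2.3] -/
theorem IsSemialgebraic.exists_forall_encard_fibre_one_le {s : Set (Fin (n + 1) → ℝ)}
    (hs : IsSemialgebraic k s) :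
    ∃ B : ℕ, ∀ β : Fin n → ℝ, {t : ℝ | (Fin.snoc β t : Fin (n + 1) → ℝ) ∈ s}.Countable →
      {t : ℝ | (Fin.snoc β t : Fin (n + 1) → ℝ) ∈ s}.encard ≤ B := by
  classical
  obtain ⟨Q, T, rfl⟩ := hs.exists_eq_setOf_signVec_mem
  refine ⟨∑ q ∈ Q, q.totalDegree, fun β hcount => ?_⟩
  set F : Set ℝ := {t : ℝ | (Fin.snoc β t : Fin (n + 1) → ℝ) ∈
    {x | (fun q : Q => SignType.sign (aeval x (q : MvPolynomial (Fin (n + 1)) k))) ∈ T}} with hF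
  -- the roots of the nonzero specialisations
  set Rt : Finset ℝ := Q.biUnion fun q =>
    if specLast q β = 0 then ∅ else (specLast q β).roots.toFinset with hRt
  have hsub : F ⊆ ↑Rt := by
    intro t ht
    by_contra hnot
    -- no nonzero specialisation vanishes at `t`: all signs are locally constant near `t`
    have hne : ∀ q ∈ Q, specLast q β ≠ 0 → (specLast q β).eval t ≠ 0 := by
      intro q hq hq0 heval
      apply hnot
      rw [Finset.mem_coe, hRt, Finset.mem_biUnion]
      refine ⟨q, hq, ?_⟩
      rw [if_neg hq0, Multiset.mem_toFinset, Polynomial.mem_roots hq0]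
      exact heval
    have hloc : ∀ q ∈ Q, ∀ᶠ t' in nhds t,
        SignType.sign ((specLast q β).eval t') = SignType.sign ((specLast q β).eval t) := by
      intro q hq
      by_cases hq0 : specLast q β = 0
      · simp [hq0]
      · have hcont : ContinuousAt (fun t' => (specLast q β).eval t') t :=
          (specLast q β).continuous.continuousAt
        rcases lt_trichotomy ((specLast q β).eval t) 0 with hlt | heq | hgt
        · filter_upwards [hcont.eventually (gt_mem_nhds hlt)] with t' ht'
          rw [sign_neg ht', sign_neg hlt]
        · exact (hne q hq hq0 heq).elim
        · filter_upwards [hcont.eventually (lt_mem_nhds hgt)] with t' ht'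
          rw [sign_pos ht', sign_pos hgt]
    have hall : ∀ᶠ t' in nhds t, ∀ q ∈ Q,
        SignType.sign ((specLast q β).eval t') = SignType.sign ((specLast q β).eval t) :=
      (Q.eventually_all).2 hloc
    have hnhds : ∀ᶠ t' in nhds t, t' ∈ F := by
      filter_upwards [hall] with t' ht'
      have e : (fun q : Q => SignType.sign (aeval (Fin.snoc β t' : Fin (n + 1) → ℝ)
          (q : MvPolynomial (Fin (n + 1)) k))) =
          fun q : Q => SignType.sign (aeval (Fin.snoc β t : Fin (n + 1) → ℝ)
            (q : MvPolynomial (Fin (n + 1)) k)) := by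
        funext q
        rw [← eval_specLast, ← eval_specLast, ht' q q.2]
      show (fun q : Q => SignType.sign (aeval (Fin.snoc β t' : Fin (n + 1) → ℝ)
          (q : MvPolynomial (Fin (n + 1)) k))) ∈ T
      rw [e]
      exact ht
    -- hence `F` contains an interval: not countable
    obtain ⟨ε, hε, hball⟩ := Metric.eventually_nhds_iff.1 hnhds
    have hIoo : Ioo (t - ε / 2) (t + ε / 2) ⊆ F := fun t' ht' => hball (by
      rw [Real.dist_eq, abs_lt]; constructor <;> linarith [ht'.1, ht'.2])
    have hc : (Ioo (t - ε / 2) (t + ε / 2)).Countable := hcount.mono hIoo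
    have h0 : MeasureTheory.volume (Ioo (t - ε / 2) (t + ε / 2)) = 0 := hc.measure_zero _
    rw [Real.volume_Ioo, ENNReal.ofReal_eq_zero] at h0
    linarith
  calc F.encard ≤ (↑Rt : Set ℝ).encard := encard_le_encard hsub
    _ = Rt.card := encard_coe_eq_coe_finsetCard Rt
    _ ≤ ((∑ q ∈ Q, q.totalDegree : ℕ) : ℕ∞) := by
        have h1 : Rt.card ≤ ∑ q ∈ Q, q.totalDegree := by
          refine Finset.card_biUnion_le.trans (Finset.sum_le_sum fun q _ => ?_)
          split_ifs with h0
          · simp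
          · exact (Multiset.toFinset_card_le _).trans
              (((specLast q β).card_roots').trans (natDegree_specLast_le q β))
        exact_mod_cast h1

end One

/-! ### Several coordinates -/

section Several

variable {k : Type*} [CommRing k] [Algebra k ℝ]

/-- **Uniform finiteness for countable fibres.** For a `k`-semialgebraic `s ⊆ ℝ^{m+N}` there is
`B ∈ ℕ` such that every countable fibre `{x ∈ ℝᴺ | (β, x) ∈ s}` has at most `B` elements
(induction on `N`: the projection of `s` forgetting the last coordinate is semialgebraic by the
Tarski–Seidenberg theorem and has countable fibres of size `≤ B'`, and over each of its points
the last coordinate ranges over a countable fibre of `s`, of size `≤ B₁` by the one-variable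
case; `B = B' B₁`). Special case, for countable fibres, of the uniform finiteness theorem for
definable families (van den Dries 1998, Ch. 3, (3.7)). [cite: BochnakCosteRoy1998, Thm. 2.2.1 and §2.3] -/
theorem IsSemialgebraic.exists_forall_encard_fibre_le :
    ∀ (N m : ℕ) (s : Set (Fin (m + N) → ℝ)), IsSemialgebraic k s →
      ∃ B : ℕ, ∀ β : Fin m → ℝ, {x : Fin N → ℝ | Fin.append β x ∈ s}.Countable →
        {x : Fin N → ℝ | Fin.append β x ∈ s}.encard ≤ B := by
  intro N
  induction N with
  | zero =>
    intro m s _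
    refine ⟨1, fun β _ => ?_⟩
    refine (encard_le_encard (subset_univ _)).trans ?_
    rw [encard_univ]
    simp
  | succ N ih =>
    intro m s hs
    -- the projection forgetting the last coordinate
    set s' : Set (Fin (m + N) → ℝ) := (fun x : Fin (m + N + 1) → ℝ => x ∘ Fin.castSucc) '' s
      with hs'
    have hs's : IsSemialgebraic k s' := tarski_seidenberg_real_holds hs
    obtain ⟨B', hB'⟩ := ih m s' hs's
    -- the one-variable bound, parameters in `ℝ^{m+N}`
    obtain ⟨B₁, hB₁⟩ := IsSemialgebraic.exists_forall_encard_fibre_one_le (n := m + N) hs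
    refine ⟨B' * B₁, fun β hcount => ?_⟩
    set F : Set (Fin (N + 1) → ℝ) := {x | Fin.append β x ∈ s} with hF
    -- slices and the projected fibre
    set F' : Set (Fin N → ℝ) := {x' | Fin.append β x' ∈ s'} with hF'
    set Sl : (Fin N → ℝ) → Set ℝ := fun x' =>
      {t | (Fin.snoc (Fin.append β x') t : Fin (m + N + 1) → ℝ) ∈ s} with hSl
    have happ : ∀ (x' : Fin N → ℝ) (t : ℝ),
        (Fin.snoc (Fin.append β x') t : Fin (m + N + 1) → ℝ) = Fin.append β (Fin.snoc x' t) :=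
      fun x' t => (Fin.append_snoc β x' t).symm
    have hmemF : ∀ x : Fin (N + 1) → ℝ, x ∈ F ↔ x (Fin.last N) ∈ Sl (Fin.init x) := by
      intro x
      simp only [hF, hSl, mem_setOf_eq, happ, Fin.snoc_init_self]
    -- slices are countable, hence of size `≤ B₁`
    have hSlc : ∀ x', (Sl x').Countable := by
      intro x'
      have hinj : Set.InjOn (fun t : ℝ => (Fin.snoc x' t : Fin (N + 1) → ℝ)) (Sl x') :=
        fun t _ t' _ h => by simpa using congrFun h (Fin.last N)
      refine MapsTo.countable_of_injOn (fun t ht => ?_) hinj hcount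
      show Fin.append β (Fin.snoc x' t) ∈ s
      rw [← happ]; exact ht
    have hSlB : ∀ x', (Sl x').encard ≤ B₁ := fun x' => hB₁ (Fin.append β x') (hSlc x')
    -- the projected fibre is countable, hence of size `≤ B'`
    have hF'eq : F' = Fin.init '' F := by
      ext x'
      simp only [hF', hs', mem_setOf_eq, mem_image]
      constructor
      · rintro ⟨y, hy, hyx⟩
        refine ⟨Fin.snoc x' (y (Fin.last _)), ?_, by simp⟩
        have e : Fin.append β (Fin.snoc x' (y (Fin.last (m + N)))) = y := by
          rw [← happ, ← hyx]
          exact Fin.snoc_init_self y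
        show Fin.append β (Fin.snoc x' (y (Fin.last (m + N)))) ∈ s
        rw [e]; exact hy
      · rintro ⟨x, hx, rfl⟩
        refine ⟨(Fin.append β x : Fin (m + (N + 1)) → ℝ), hx, ?_⟩
        funext j
        simp only [Function.comp_apply]
        refine Fin.addCases (fun i => ?_) (fun i => ?_) j
        · rw [Fin.append_left]
          have : (Fin.castSucc (Fin.castAdd N i) : Fin (m + N + 1)) = Fin.castAdd (N + 1) i :=
            Fin.ext rfl
          rw [this, Fin.append_left]
        · rw [Fin.append_right]
          have : (Fin.castSucc (Fin.natAdd m i) : Fin (m + N + 1)) =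
              Fin.natAdd m (Fin.castSucc i) := Fin.ext rfl
          rw [this, Fin.append_right]
          rfl
    have hF'c : F'.Countable := by rw [hF'eq]; exact hcount.image _
    have hF'B : F'.encard ≤ B' := hB' β hF'c
    -- count: `F ⊆ ⋃_{x' ∈ F'} snoc x' '' Sl x'`
    have hF'fin : F'.Finite := finite_of_encard_le_coe hF'B
    set K : Finset (Fin N → ℝ) := hF'fin.toFinset with hK
    have hKcard : (K.card : ℕ∞) ≤ B' := by
      rw [hK, ← hF'fin.encard_eq_coe_toFinset_card]; exact hF'B
    have hcover : F ⊆ ⋃ x' ∈ (K : Set (Fin N → ℝ)),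
        (fun t => (Fin.snoc x' t : Fin (N + 1) → ℝ)) '' Sl x' := by
      intro x hx
      have hx' : Fin.init x ∈ (K : Set (Fin N → ℝ)) := by
        rw [hK, hF'fin.coe_toFinset, hF'eq]; exact mem_image_of_mem _ hx
      exact mem_biUnion hx' ⟨x (Fin.last N), (hmemF x).1 hx, Fin.snoc_init_self x⟩
    calc F.encard ≤ (⋃ x' ∈ (K : Set (Fin N → ℝ)),
        (fun t => (Fin.snoc x' t : Fin (N + 1) → ℝ)) '' Sl x').encard := encard_le_encard hcover
      _ ≤ ∑ x' ∈ K, ((fun t => (Fin.snoc x' t : Fin (N + 1) → ℝ)) '' Sl x').encard :=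
          K.set_encard_biUnion_le _
      _ ≤ ∑ x' ∈ K, (B₁ : ℕ∞) :=
          Finset.sum_le_sum fun x' _ => (encard_image_le _ _).trans (hSlB x')
      _ = K.card * B₁ := by rw [Finset.sum_const, nsmul_eq_mul]
      _ ≤ B' * B₁ := by gcongr

/-- `Fin.append β x` is `Sum.elim β x` read through `finSumFinEquiv`. [folklore] -/
theorem append_comp_finSumFinEquiv {m N : ℕ} (β : Fin m → ℝ) (x : Fin N → ℝ) :
    Fin.append β x ∘ ⇑finSumFinEquiv = Sum.elim β x := by
  funext i
  rcases i with i | i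
  · simp
  · simp

/-- **Uniform finiteness for countable fibres, `Sum.elim` form.** For a `k`-semialgebraic set
`s` of points `ℝ^{m ⊕ N}` there is `B ∈ ℕ` such that for every parameter `β ∈ ℝᵐ` whose fibre
`{x ∈ ℝᴺ | Sum.elim β x ∈ s}` is countable, this fibre has at most `B` elements.
[cite: BochnakCosteRoy1998, Thm. 2.2.1 and §2.3] -/
theorem IsSemialgebraic.exists_forall_encard_sumElim_le {m N : ℕ} {s : Set (Fin m ⊕ Fin N → ℝ)}
    (hs : IsSemialgebraic k s) :
    ∃ B : ℕ, ∀ β : Fin m → ℝ, {x : Fin N → ℝ | Sum.elim β x ∈ s}.Countable →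
      {x : Fin N → ℝ | Sum.elim β x ∈ s}.encard ≤ B := by
  set s' : Set (Fin (m + N) → ℝ) := (fun y : Fin (m + N) → ℝ => y ∘ ⇑finSumFinEquiv) ⁻¹' s
    with hs'
  have hs's : IsSemialgebraic k s' := hs.preimage_comp _
  obtain ⟨B, hB⟩ := IsSemialgebraic.exists_forall_encard_fibre_le N m s' hs's
  refine ⟨B, fun β => ?_⟩
  have e : {x : Fin N → ℝ | Sum.elim β x ∈ s} = {x : Fin N → ℝ | Fin.append β x ∈ s'} := by
    ext x
    simp only [mem_setOf_eq, hs', mem_preimage, append_comp_finSumFinEquiv]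
  rw [e]
  exact hB β

end Several

end Literature.ModelTheory.ExponentialFields
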